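import Summits.AtomisticToContinuum.Crystallization.Theorems.ReggeStarCoercivityDefectFreeCrystallizesExactFrameH
import Literature.Geometry.DiscreteGeometry.KissingPatterns
import Literature.Probability.Process.PointStationaryLaw

/-!
# Exact stars at an h-type site give an exact frame — first-shell form (stub `stub_exactFrameHB`, X2a of line
# `palm-good-law`, crux `ReggeStarCoercivity.DefectFreeCrystallizes`, stmt-AtomisticToContinuum-13603)

This is the FIRST-SHELL form of X2a.  The landed `ExactFrameH.stub_exactFrameH` asks the annulus
`{y | 11/10 < ‖y‖ ∧ ‖y‖ ≤ 5/4}` of the configuration re-rooted at `X u` to be empty, but its proof uses that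
hypothesis only to see that a chart contact of `u` — an atom at distance in `(0, 6/5)` — already lies within
`11/10` of `X u`, i.e. only on the range `(11/10, 6/5)`.  Here the empty-annulus hypothesis is weakened to
exactly that range, `{y | 11/10 < ‖y‖ ∧ ‖y‖ < 6/5}`:

Let `s` be a Hägg word, `X : ℤ³ → ℝ³` an injective CHART of a configuration against the ideal stacking
`barlowStacking 1 √(2/3) s` (ideal contacts `dist = 1` ↔ pairs at distance in `(0, 6/5)`), and `u` an h-type
site (`s (u.1 − 1) ≠ s u.1`).  If the root star of the configuration re-rooted at `X u` is EXACT — congruence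
defect `0` against the relaxed hcp star `hcpSite a₀ h₀` OR against the regular cuboctahedron
`a₀ • fccKissingPattern` — and the thin annulus `11/10 < ‖y‖ < 6/5` is empty, then ONE linear isometry `A`
carries the relaxed struts `barlowPos a₀ h₀ s w − barlowPos a₀ h₀ s u` of the twelve contacts `w` of `u` onto
`X w − X u` (`stub_exactFrameHB`).

* `rootStar_eqB`: by the chart and the empty thin annulus the root star is the labelled twelve-point set
  `{X (N ε) − X u : ε ∈ hcpStarIdx}` (`count_restrict_singleton_ne_zero_iff`);
* the two branches are the guard-free `ExactFrameH.fcc_branch_false` (type gap) and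
  `ExactFrameH.hcp_branch_frame` (labelled exact star and its frame), referenced, not copied.

All `[folklore]`.
-/

noncomputable section

open scoped BigOperators
open MeasureTheory

namespace Summit.AtomisticToContinuum.Crystallization.Theorems.PalmGoodLaw.ExactFrameHB

open Literature.MathematicalPhysics.StatisticalMechanics Literature.Geometry.DiscreteGeometry
open Literature.Probability.Process
open Summit.AtomisticToContinuum.Crystallization.Theorems.PalmUnimodularRigidity.LayeredLawsSelectHcp
open Summit.AtomisticToContinuum.Crystallization.Theorems.PalmGoodLaw.ExactFrameH
open scoped RealInnerProductSpace

section Chart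

variable {a₀ h₀ : ℝ} {s : ℤ → ℤ} {X : ℤ × ℤ × ℤ → EuclideanSpace ℝ (Fin 3)} {u : ℤ × ℤ × ℤ}
  {N : ℤ × ℤ × ℤ → ℤ × ℤ × ℤ}

/-! ## The root star of the re-rooted configuration (thin annulus) -/

/-- **The root star of the configuration re-rooted at `X u` is the labelled image of the twelve contacts of
`u`** (first-shell form): contacts are atoms at distance in `(0, 6/5)` (chart), the thin annulus
`(11/10, 6/5)` is empty, and the atoms of `count|T` are the points of `T`. [folklore] -/
theorem rootStar_eqB (hs : IsHaggSeq s) (hu : s (u.1 - 1) ≠ s u.1)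
    (hN : ∀ ε, N ε = (u.1 + ε.1, u.2.1 + s u.1 * ε.2.1, u.2.2 + s u.1 * ε.2.2))
    (hchart : ∀ u w : ℤ × ℤ × ℤ, dist (barlowPos 1 (Real.sqrt (2 / 3)) s u.1 u.2.1 u.2.2)
      (barlowPos 1 (Real.sqrt (2 / 3)) s w.1 w.2.1 w.2.2) = 1 ↔ (0 < dist (X u) (X w) ∧ dist (X u) (X w) < 6 / 5))
    (hann : (Measure.count : Measure (EuclideanSpace ℝ (Fin 3))).restrict
      ((fun z : EuclideanSpace ℝ (Fin 3) => z - X u) '' Set.range X)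
      {y : EuclideanSpace ℝ (Fin 3) | 11 / 10 < ‖y‖ ∧ ‖y‖ < 6 / 5} = 0) :
    rootStar ((Measure.count : Measure (EuclideanSpace ℝ (Fin 3))).restrict
        ((fun z : EuclideanSpace ℝ (Fin 3) => z - X u) '' Set.range X)) =
      ↑(hcpStarIdx.image fun ε => X (N ε) - X u) := by
  -- no atom in the thin annulus
  have hgap : ∀ w, ¬ (11 / 10 < ‖X w - X u‖ ∧ ‖X w - X u‖ < 6 / 5) := by
    intro w hw
    have hle := Measure.le_restrict_apply (μ := (Measure.count : Measure (EuclideanSpace ℝ (Fin 3))))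
      ((fun z : EuclideanSpace ℝ (Fin 3) => z - X u) '' Set.range X)
      {y : EuclideanSpace ℝ (Fin 3) | 11 / 10 < ‖y‖ ∧ ‖y‖ < 6 / 5}
    rw [hann, nonpos_iff_eq_zero, Measure.count_eq_zero_iff, Set.eq_empty_iff_forall_notMem] at hle
    exact hle (X w - X u) ⟨hw, X w, ⟨w, rfl⟩, rfl⟩
  ext y
  simp only [rootStar, Set.mem_setOf_eq, count_restrict_singleton_ne_zero_iff, Set.mem_image,
    Set.mem_range, exists_exists_eq_and, Finset.coe_image, Finset.mem_coe]
  constructor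
  · rintro ⟨⟨w, rfl⟩, hpos, hle⟩
    have hd : 0 < dist (X u) (X w) ∧ dist (X u) (X w) < 6 / 5 := by
      rw [dist_comm, dist_eq_norm]; exact ⟨hpos, by linarith⟩
    obtain ⟨ε, hε, rfl⟩ := (dist_eq_one_iff_nbr hs hu hN w).1 ((hchart u w).2 hd)
    exact ⟨ε, hε, rfl⟩
  · rintro ⟨ε, hε, rfl⟩
    have h1 := (dist_eq_one_iff_nbr hs hu hN (N ε)).2 ⟨ε, hε, rfl⟩
    obtain ⟨hpos, hlt⟩ := (hchart u _).1 h1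
    rw [dist_comm, dist_eq_norm] at hpos hlt
    refine ⟨⟨_, rfl⟩, hpos, ?_⟩
    by_contra hgt
    exact hgap _ ⟨not_le.1 hgt, hlt⟩

end Chart

/-! ## The registered stub -/

/-- **Stub `stub_exactFrameHB` (X2a of line `palm-good-law`, first-shell form): exact stars at an h-type site
give an exact frame.**  For a Hägg word `s`, an injective chart `X : ℤ³ → ℝ³` against the ideal stacking
(ideal contacts ↔ pairs at distance in `(0, 6/5)`), and an h-type site `u` (`s (u.1 − 1) ≠ s u.1`) whose
re-rooted root star is exact (defect `0` against the relaxed hcp star OR against `a₀ • fccKissingPattern`) with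
empty thin annulus `(11/10, 6/5)`, one linear isometry `A` gives
`X w − X u = A (barlowPos a₀ h₀ s w − barlowPos a₀ h₀ s u)` for all contacts `w` of `u`.  The root star is the
labelled image of the twelve contacts (`rootStar_eqB`); the fcc branch is impossible
(`ExactFrameH.fcc_branch_false`, type gap); in the hcp branch `ExactFrameH.hcp_branch_frame` gives `A` on the
relaxed struts of the labelled contacts, which are all the contacts (`ExactFrameH.dist_eq_one_iff_nbr`).
[folklore] -/
theorem stub_exactFrameHB :
    ∀ a₀ h₀ : ℝ, 189 / 200 ≤ a₀ → a₀ ≤ 199 / 200 → 77 / 100 ≤ h₀ → h₀ ≤ 163 / 200 →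
      ∀ s : ℤ → ℤ, IsHaggSeq s →
      ∀ X : ℤ × ℤ × ℤ → EuclideanSpace ℝ (Fin 3), Function.Injective X →
        (∀ u w : ℤ × ℤ × ℤ,
          dist (barlowPos 1 (Real.sqrt (2 / 3)) s u.1 u.2.1 u.2.2) (barlowPos 1 (Real.sqrt (2 / 3)) s w.1 w.2.1 w.2.2) = 1 ↔
            (0 < dist (X u) (X w) ∧ dist (X u) (X w) < 6 / 5)) →
        ∀ u : ℤ × ℤ × ℤ, s (u.1 - 1) ≠ s u.1 →
          (Summit.AtomisticToContinuum.Crystallization.Theorems.PalmUnimodularRigidity.LayeredLawsSelectHcp.starDefect a₀ h₀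
              ((Measure.count : Measure (EuclideanSpace ℝ (Fin 3))).restrict
                ((fun z : EuclideanSpace ℝ (Fin 3) => z - X u) '' Set.range X)) = 0 ∨
            (⨅ A : EuclideanSpace ℝ (Fin 3) ≃ₗᵢ[ℝ] EuclideanSpace ℝ (Fin 3),
              ∑ p ∈ fccKissingPattern, Metric.infDist (A (a₀ • p))
                (Summit.AtomisticToContinuum.Crystallization.Theorems.PalmUnimodularRigidity.LayeredLawsSelectHcp.rootStar
                  ((Measure.count : Measure (EuclideanSpace ℝ (Fin 3))).restrict
                    ((fun z : EuclideanSpace ℝ (Fin 3) => z - X u) '' Set.range X))) ^ 2) = 0) →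
          (Measure.count : Measure (EuclideanSpace ℝ (Fin 3))).restrict
              ((fun z : EuclideanSpace ℝ (Fin 3) => z - X u) '' Set.range X)
              {y : EuclideanSpace ℝ (Fin 3) | 11 / 10 < ‖y‖ ∧ ‖y‖ < 6 / 5} = 0 →
          ∃ A : EuclideanSpace ℝ (Fin 3) ≃ₗᵢ[ℝ] EuclideanSpace ℝ (Fin 3), ∀ w : ℤ × ℤ × ℤ,
            dist (barlowPos 1 (Real.sqrt (2 / 3)) s u.1 u.2.1 u.2.2) (barlowPos 1 (Real.sqrt (2 / 3)) s w.1 w.2.1 w.2.2) = 1 →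
            X w - X u = A (barlowPos a₀ h₀ s w.1 w.2.1 w.2.2 - barlowPos a₀ h₀ s u.1 u.2.1 u.2.2) := by
  intro a₀ h₀ ha₁ ha₂ hh₁ hh₂ s hs X hX hchart u hu hstar hann
  have hN : ∀ ε : ℤ × ℤ × ℤ,
      (fun ε : ℤ × ℤ × ℤ => (u.1 + ε.1, u.2.1 + s u.1 * ε.2.1, u.2.2 + s u.1 * ε.2.2)) ε =
        (u.1 + ε.1, u.2.1 + s u.1 * ε.2.1, u.2.2 + s u.1 * ε.2.2) := fun _ => rfl
  have hZ := rootStar_eqB hs hu hN hchart hann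
  rcases hstar with hhcp | hfcc
  · rw [starDefect, hZ] at hhcp
    obtain ⟨A, hA⟩ := hcp_branch_frame ha₁ ha₂ hh₁ hh₂ hs hN hchart hu hhcp
    refine ⟨A, fun w hw => ?_⟩
    obtain ⟨ε, hε, rfl⟩ := (dist_eq_one_iff_nbr hs hu hN w).1 hw
    exact hA ε hε
  · rw [hZ] at hfcc
    exact (fcc_branch_false ha₁ hs hX hN hchart hu hfcc).elim

end Summit.AtomisticToContinuum.Crystallization.Theorems.PalmGoodLaw.ExactFrameHB

end
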